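import Summits.ValiantsHypothesis.ValiantsHypothesis.Theorems.KPlusLogSqLawTropicalBToeplitzDoubling
import Summits.ValiantsHypothesis.ValiantsHypothesis.Theorems.KPlusLogSqLawTropicalBToeplitzThirtyTwo161
import Summits.ValiantsHypothesis.ValiantsHypothesis.Theorems.KPlusLogSqLawTropicalBToeplitzTwenty79

/-!
# Route `KPlusLogSqLaw`, crux `TropicalB` — Toeplitz sector: the doubling TOWERS, and super-linearity CONDITIONAL on the morph-doubling law

HONEST FRAMING.  Helper (`--supports stmt-ValiantsHypothesis-19771`; cell `pub-symmetroid`, seat `val-sym-trop-p4` (g22), 2026-08-29).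
TOWERS (section `Tower`, unconditional): iterating the kernel doubling law `fixedSlope_sq_doubling` (`…ToeplitzDoubling`) on the kernel rows
`Φ_Q(32) ≥ 161` (`…ToeplitzThirtyTwo161`) and `Φ_Q(20) ≥ 79` (`…ToeplitzTwenty79`): for every `k`, `¬ FixedSlopeInstanceBound (32·2^k) (·²) (160·2^k)` and
`¬ FixedSlopeInstanceBound (20·2^k) (·²) (78·2^k)` — all-size LINEAR floors (slope 5 resp. 3.9) along the doubling sequences; in particular the cell's located
law `ConjectureTSharp` («`Φ_Toep(m) ≤ 5m`») fails at EVERY size `32·2^k` (`not_linearInstanceBound_tower`).  These floors are linear; the located truth (memo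
HOME/val-sym-trop-p4/g22/DOUBLING-g22.md §2: 185, 650 at m = 32, 64) is far above them — the plain law does not see the bottom phase.
CONDITIONAL SUPER-LINEARITY (section `Morph`; HYPOTHESIS `hM`, NOT proved here or anywhere): the memo's MORPH-DOUBLING LAW «for even n ≥ 4,
Φ_Q(2n)+1 ≥ (Φ_Q(n)+1) + (Φ_Q(n)′+1) + (n − 1)» — doubling WITH the bottom phase: the explicit morph family μ_j, ν_i of 2q staircase zippers is the set of
unique optima of k·Σ|δ| − Σδ² between the q-ladder and the half swap (memo §2c: exact for m ≤ 64, strict certificates for every q ≤ 32; the all-q proof —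
a Toeplitz assignment problem with closed-form triangle-wave duals — is OPEN).  Under `hM` the same induction gives `Φ_Q(32·2^k) ≥ 2^k·(159 + 16k) + 1`,
hence `¬ConjectureQ` and `¬ConjectureTLinear` (theorems `…_of_morph`, recorded by the gate as conditional) — so that whoever proves the law closes both.
`ConjectureTPoly` is untouched by all of this; nothing here bears on `TropicalB` for general designs, `MatrixDescartes` or `VP ≠ VNP`.
-/

set_option linter.dupNamespace false
set_option autoImplicit false

namespace Summit.ValiantsHypothesis.ValiantsHypothesis.Theorems.KPlusLogSqLaw.Toeplitz

section Tower

/-- **The `32·2^k` tower**: `Φ_Q(32·2^k) ≥ 160·2^k + 1` for every `k`. -/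
theorem not_fixedSlopeInstanceBound_sq_tower32 (k : ℕ) :
    ¬ FixedSlopeInstanceBound (32 * 2 ^ k) (fun δ : ℤ => δ ^ 2) (160 * 2 ^ k) := by
  induction k with
  | zero =>
    intro h
    have := le_of_fixedSlopeInstanceBound_sq_thirtytwo_161 (by simpa using h)
    omega
  | succ k ih =>
    have e1 : 32 * 2 ^ (k + 1) = 32 * 2 ^ k + 32 * 2 ^ k := by ring
    have e2 : 160 * 2 ^ (k + 1) = 160 * 2 ^ k + 160 * 2 ^ k := by ring
    rw [e1, e2]
    exact fixedSlope_sq_doubling ih ih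

/-- **The `20·2^k` tower**: `Φ_Q(20·2^k) ≥ 78·2^k + 1` for every `k`. -/
theorem not_fixedSlopeInstanceBound_sq_tower20 (k : ℕ) :
    ¬ FixedSlopeInstanceBound (20 * 2 ^ k) (fun δ : ℤ => δ ^ 2) (78 * 2 ^ k) := by
  induction k with
  | zero =>
    intro h
    have := le_of_fixedSlopeInstanceBound_sq_twenty_79 (by simpa using h)
    omega
  | succ k ih =>
    have e1 : 20 * 2 ^ (k + 1) = 20 * 2 ^ k + 20 * 2 ^ k := by ring
    have e2 : 78 * 2 ^ (k + 1) = 78 * 2 ^ k + 78 * 2 ^ k := by ring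
    rw [e1, e2]
    exact fixedSlope_sq_doubling ih ih

/-- **`ConjectureTSharp` fails at every size `32·2^k`**: `¬ LinearInstanceBound (32·2^k) (5·(32·2^k))`. -/
theorem not_linearInstanceBound_tower (k : ℕ) : ¬ LinearInstanceBound (32 * 2 ^ k) (5 * (32 * 2 ^ k)) := by
  intro h
  have hq : FixedSlopeInstanceBound (32 * 2 ^ k) (fun δ : ℤ => δ ^ 2) (160 * 2 ^ k) := by
    have := (linearInstanceBound_iff_fixedSlope (32 * 2 ^ k) (5 * (32 * 2 ^ k))).mp h (fun δ : ℤ => δ ^ 2)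
    have e : 5 * (32 * 2 ^ k) = 160 * 2 ^ k := by ring
    rw [e] at this; exact this
  exact not_fixedSlopeInstanceBound_sq_tower32 k hq

/-- **All-size linear floor along the tower**: `LinearInstanceBound (32·2^k) Φ → 160·2^k + 1 ≤ Φ`. -/
theorem le_of_linearInstanceBound_tower32 (k : ℕ) {Φ : ℕ} (h : LinearInstanceBound (32 * 2 ^ k) Φ) : 160 * 2 ^ k + 1 ≤ Φ := by
  rcases Nat.lt_or_ge Φ (160 * 2 ^ k + 1) with hlt | hge
  · exact absurd ((linearInstanceBound_iff_fixedSlope _ _).mp (h.mono (by omega)) (fun δ : ℤ => δ ^ 2))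
      (not_fixedSlopeInstanceBound_sq_tower32 k)
  · exact hge

end Tower

section Morph

/-! ### Conditional super-linearity: the morph-doubling law as an explicit hypothesis (memo §2c; NOT proved) -/

variable (hM : ∀ n N₁ N₂ : ℕ, 4 ≤ n → Even n →
    ¬ FixedSlopeInstanceBound n (fun δ : ℤ => δ ^ 2) N₁ → ¬ FixedSlopeInstanceBound n (fun δ : ℤ => δ ^ 2) N₂ →
    ¬ FixedSlopeInstanceBound (n + n) (fun δ : ℤ => δ ^ 2) (N₁ + N₂ + (n - 1)))
include hM

/-- **Super-linear tower under the morph-doubling law** (CONDITIONAL on `hM`): `Φ_Q(32·2^k) ≥ 2^k·(159 + 16k) + 1`. -/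
theorem not_fixedSlopeInstanceBound_sq_tower32_of_morph (k : ℕ) :
    ¬ FixedSlopeInstanceBound (32 * 2 ^ k) (fun δ : ℤ => δ ^ 2) (2 ^ k * (159 + 16 * k) + 1) := by
  induction k with
  | zero => simpa using not_fixedSlopeInstanceBound_sq_tower32 0
  | succ k ih =>
    have hP : 1 ≤ 2 ^ k := Nat.one_le_two_pow
    have h4 : 4 ≤ 32 * 2 ^ k := by omega
    have hev : Even (32 * 2 ^ k) := ⟨16 * 2 ^ k, by ring⟩
    have h := hM _ _ _ h4 hev ih ih
    have e1 : 32 * 2 ^ (k + 1) = 32 * 2 ^ k + 32 * 2 ^ k := by ring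
    have e2 : 2 ^ (k + 1) * (159 + 16 * (k + 1)) + 1 =
        (2 ^ k * (159 + 16 * k) + 1) + (2 ^ k * (159 + 16 * k) + 1) + (32 * 2 ^ k - 1) := by
      zify [show 1 ≤ 32 * 2 ^ k by omega]
      ring
    rw [e1, e2]
    exact h

/-- **`ConjectureQ` is false under the morph-doubling law** (CONDITIONAL on `hM`). -/
theorem not_conjectureQ_of_morph : ¬ ConjectureQ := by
  rintro ⟨C, hC⟩
  have h := hC (32 * 2 ^ (2 * C))
  have hle : C * (32 * 2 ^ (2 * C)) ≤ 2 ^ (2 * C) * (159 + 16 * (2 * C)) + 1 := by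
    have e : C * (32 * 2 ^ (2 * C)) = 2 ^ (2 * C) * (32 * C) := by ring
    rw [e]
    exact le_trans (Nat.mul_le_mul_left _ (by omega)) (Nat.le_succ _)
  exact not_fixedSlopeInstanceBound_sq_tower32_of_morph hM (2 * C) (h.mono hle)

/-- **`ConjectureTLinear` is false under the morph-doubling law** (CONDITIONAL on `hM`). -/
theorem not_conjectureTLinear_of_morph : ¬ ConjectureTLinear := fun h =>
  not_conjectureQ_of_morph hM (conjectureQ_of_TLinear h)

end Morph

end Summit.ValiantsHypothesis.ValiantsHypothesis.Theorems.KPlusLogSqLaw.Toeplitz
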